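import Literature.AlgebraicGeometry.KTheory.PullbackVectorBundle
import Literature.AlgebraicGeometry.Modules.SectionsExact
import Mathlib.AlgebraicGeometry.Morphisms.ClosedImmersion
import Mathlib.Algebra.Homology.ShortComplex.ShortExact

/-!
# The abstract `p`-adic ladder: a short exact sequence from two reduction maps (support for EB1)

Support lemmas for stub EB1 (`stub_towerPresentation`) of line `chow-zariski-pushforward` of the crux
`FormalVectorBundlesAlgebraize` (route `PadicSemiregularLift` of `HodgeConjecture`).

**Locality.** A morphism of `𝒪_X`-modules is a monomorphism / an epimorphism / equal to another one as
soon as it is injective / surjective / agrees with it on the affine opens inside the members of an open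
cover (`mono_of_locally_injective`, `epi_of_locally_surjective`, `hom_eq_of_locally_eq`); such
neighbourhood-wise hypotheses on `Y` transfer to `Z` along a closed immersion `Y ⟶ Z`
(`exists_nhds_preimage_of_isClosedImmersion`).

**The ladder** (`ladderCore`). Let `φ : N ⟶ P` and `ρ : N ⟶ R` be morphisms of `𝒪_Y`-modules and
`a, b ∈ ℕ` such that, on the small affine opens `V`: `φ` and `ρ` are surjective with kernels `a·Γ(N, V)`
and `b·Γ(N, V)`, `a·x = 0 ⟹ x ∈ b·Γ(N, V)` (flatness) and `ab·Γ(N, V) = 0`. Then `φ` is an epimorphism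
and multiplication by `a` descends along `ρ` to an ISOMORPHISM `R ⥲ ker φ` (the model is
`N = F` a vector bundle on `Z ⊗ W/p^{n+2}`, `φ`, `ρ` the reductions modulo `p^{n+1}` and `p`,
`a = p^{n+1}`, `b = p`: `0 → F ⊗ W/p —p^{n+1}→ F → F ⊗ W/p^{n+1} → 0`). The short exact sequence is
then pushed forward along a closed immersion (`shortExact_pushforward_of_isIso_kernelComparison`).
Everything is proved; no definitions.
-/

noncomputable section

-- Summit.HodgeConjecture.HodgeConjecture.… repeats the summit name by the D-0017 layout (Sub = Summit).
set_option linter.dupNamespace false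
-- `TopCat.Presheaf`/`TopCat.Sheaf` are not reducible (as in Mathlib's `AlgebraicGeometry/Modules`).
set_option backward.isDefEq.respectTransparency false

open CategoryTheory CategoryTheory.Limits AlgebraicGeometry TopologicalSpace Opposite
open Literature.AlgebraicGeometry.Modules Literature.AlgebraicGeometry.KTheory

universe u

namespace Summit.HodgeConjecture.HodgeConjecture.Theorems.FormalVectorBundlesAlgebraize

variable {X Y Z : Scheme.{u}}

/-! ### Locality of mono / epi / equality -/

section Locality

variable {M N : X.Modules}

/-- Every point of an open `U` has an affine neighbourhood inside `U` and inside a prescribed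
neighbourhood. -/
theorem exists_affine_nhds_le (U : X.Opens) {x : X} (hx : x ∈ U) (U' : X.Opens) (hx' : x ∈ U') :
    ∃ V : X.Opens, IsAffineOpen V ∧ x ∈ V ∧ V ≤ U ∧ V ≤ U' := by
  obtain ⟨V, hV, hxV, hVle⟩ := Opens.isBasis_iff_nbhd.mp X.isBasis_affineOpens
    (show x ∈ U ⊓ U' from ⟨hx, hx'⟩)
  exact ⟨V, hV, hxV, hVle.trans inf_le_left, hVle.trans inf_le_right⟩

/-- **Monomorphisms are local**: injectivity on the small affine opens suffices. -/
theorem mono_of_locally_injective (φ : M ⟶ N)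
    (h : ∀ x : X, ∃ U : X.Opens, x ∈ U ∧ ∀ V : X.Opens, IsAffineOpen V → V ≤ U →
      Function.Injective (φ.app V)) : Mono φ := by
  refine mono_of_app_injective φ fun U s t hst => ?_
  choose Ux hxU hinj using h
  choose V hV hxV hVU hVU' using fun x : U => exists_affine_nhds_le U x.2 (Ux x) (hxU x)
  have hcov : U ≤ ⨆ x : U, V x := fun x hx => Opens.mem_iSup.mpr ⟨⟨x, hx⟩, hxV ⟨x, hx⟩⟩
  refine TopCat.Sheaf.eq_of_locally_eq' (⟨M.presheaf, M.isSheaf⟩ : TopCat.Sheaf Ab X.toTopCat) V U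
    (fun x => homOfLE (hVU x)) hcov s t fun x => ?_
  apply hinj x (V x) (hV x) (hVU' x)
  change φ.app (V x) (M.presheaf.map (homOfLE (hVU x)).op s) =
    φ.app (V x) (M.presheaf.map (homOfLE (hVU x)).op t)
  rw [Literature.AlgebraicGeometry.Motives.Scheme.Modules.Hom.app_map_apply,
    Literature.AlgebraicGeometry.Motives.Scheme.Modules.Hom.app_map_apply, hst]

/-- **Epimorphisms are local**: surjectivity on the small affine opens suffices. -/
theorem epi_of_locally_surjective (φ : M ⟶ N)
    (h : ∀ x : X, ∃ U : X.Opens, x ∈ U ∧ ∀ V : X.Opens, IsAffineOpen V → V ≤ U →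
      Function.Surjective (φ.app V)) : Epi φ := by
  have hls : TopCat.Presheaf.IsLocallySurjective φ.mapPresheaf := by
    rw [TopCat.Presheaf.isLocallySurjective_iff]
    intro U t x hx
    obtain ⟨Ux, hxUx, hsurj⟩ := h x
    obtain ⟨V, hV, hxV, hVU, hVU'⟩ := exists_affine_nhds_le U hx Ux hxUx
    obtain ⟨s, hs⟩ := hsurj V hV hVU' (N.presheaf.map (homOfLE hVU).op t)
    exact ⟨V, hVU, ⟨s, hs⟩, hxV⟩
  have h1 : Epi ((SheafOfModules.toSheaf X.ringCatSheaf).map φ) :=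
    (TopCat.Sheaf.isLocallySurjective_iff_epi _).mp hls
  have h2 := (SheafOfModules.toSheaf X.ringCatSheaf).epi_of_epi_map h1
  exact ⟨fun _ _ hh => (@cancel_epi _ _ _ _ _ _ h2 _ _).mp hh⟩

/-- **Isomorphisms are local**: bijectivity on the small affine opens suffices. -/
theorem isIso_of_locally_bijective (φ : M ⟶ N)
    (h : ∀ x : X, ∃ U : X.Opens, x ∈ U ∧ ∀ V : X.Opens, IsAffineOpen V → V ≤ U →
      Function.Bijective (φ.app V)) : IsIso φ := by
  haveI := mono_of_locally_injective φ fun x => by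
    obtain ⟨U, hxU, hU⟩ := h x
    exact ⟨U, hxU, fun V hV hVU => (hU V hV hVU).1⟩
  haveI := epi_of_locally_surjective φ fun x => by
    obtain ⟨U, hxU, hU⟩ := h x
    exact ⟨U, hxU, fun V hV hVU => (hU V hV hVU).2⟩
  exact isIso_of_mono_of_epi φ

/-- **Equality of morphisms is local**: agreement on the small affine opens suffices. -/
theorem hom_eq_of_locally_eq (φ ψ : M ⟶ N)
    (h : ∀ x : X, ∃ U : X.Opens, x ∈ U ∧ ∀ V : X.Opens, IsAffineOpen V → V ≤ U →
      ∀ s : Γ(M, V), φ.app V s = ψ.app V s) : φ = ψ := by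
  refine Scheme.Modules.hom_ext _ _ fun U => ?_
  ext s
  choose Ux hxU heq using h
  choose V hV hxV hVU hVU' using fun x : U => exists_affine_nhds_le U x.2 (Ux x) (hxU x)
  have hcov : U ≤ ⨆ x : U, V x := fun x hx => Opens.mem_iSup.mpr ⟨⟨x, hx⟩, hxV ⟨x, hx⟩⟩
  refine TopCat.Sheaf.eq_of_locally_eq' (⟨N.presheaf, N.isSheaf⟩ : TopCat.Sheaf Ab X.toTopCat) V U
    (fun x => homOfLE (hVU x)) hcov _ _ fun x => ?_
  change N.presheaf.map (homOfLE (hVU x)).op (φ.app U s) =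
    N.presheaf.map (homOfLE (hVU x)).op (ψ.app U s)
  rw [← Literature.AlgebraicGeometry.Motives.Scheme.Modules.Hom.app_map_apply,
    ← Literature.AlgebraicGeometry.Motives.Scheme.Modules.Hom.app_map_apply]
  exact heq x (V x) (hV x) (hVU' x) _

/-- Sections over the empty open form a subsingleton. -/
theorem subsingleton_sections_bot (M : X.Modules) : Subsingleton Γ(M, (⊥ : X.Opens)) := by
  refine ⟨fun s t => ?_⟩
  exact TopCat.Sheaf.eq_of_locally_eq' (⟨M.presheaf, M.isSheaf⟩ : TopCat.Sheaf Ab X.toTopCat)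
    (fun i : PEmpty.{u + 1} => (⊥ : X.Opens)) ⊥ (fun i => 𝟙 _) bot_le s t fun i => i.elim

/-- **Transfer of neighbourhood-wise properties along a closed immersion** `g : Y ⟶ Z`: if `Q` holds
on the affine opens inside suitable neighbourhoods of the points of `Y` (and on `⊥`), then
`Q (g⁻¹ W)` holds on the affine opens `W` inside suitable neighbourhoods of the points of `Z`. -/
theorem exists_nhds_preimage_of_isClosedImmersion (g : Y ⟶ Z) [IsClosedImmersion g]
    (Q : Y.Opens → Prop) (h0 : Q ⊥)
    (h : ∀ y : Y, ∃ U : Y.Opens, y ∈ U ∧ ∀ V : Y.Opens, IsAffineOpen V → V ≤ U → Q V) (z : Z) :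
    ∃ U' : Z.Opens, z ∈ U' ∧ ∀ W : Z.Opens, IsAffineOpen W → W ≤ U' → Q (g ⁻¹ᵁ W) := by
  by_cases hz : z ∈ Set.range g.base
  · obtain ⟨y, rfl⟩ := hz
    obtain ⟨U, hyU, hU⟩ := h y
    obtain ⟨t, ht, htU⟩ := g.isClosedEmbedding.isInducing.isOpen_iff.mp U.2
    refine ⟨⟨t, ht⟩, ?_, fun W hW hWt => hU _ (hW.preimage g) fun x hx => ?_⟩
    · have : y ∈ g.base ⁻¹' t := by rw [htU]; exact hyU
      exact this
    · have : x ∈ g.base ⁻¹' t := hWt hx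
      rw [htU] at this
      exact this
  · refine ⟨⟨(Set.range g.base)ᶜ, g.isClosedEmbedding.isClosed_range.isOpen_compl⟩, hz, ?_⟩
    intro W _ hWt
    have hbot : g ⁻¹ᵁ W = ⊥ := by
      ext x
      simp only [Opens.coe_bot, Set.mem_empty_iff_false, iff_false]
      exact fun hx => hWt hx ⟨x, rfl⟩
    rw [hbot]
    exact h0

end Locality

/-! ### The ladder -/

section Ladder

variable {N P R : Y.Modules} (φ : N ⟶ P) (ρ : N ⟶ R) (a b : ℕ)

/-- `ℕ`-multiples commute with `app`. -/
theorem nsmul_app_apply' {M M' : Y.Modules} (c : ℕ) (ψ : M ⟶ M') (V : Y.Opens) (m : Γ(M, V)) :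
    (c • ψ).app V m = c • ψ.app V m := by
  induction c with
  | zero => rw [zero_nsmul, zero_nsmul, Scheme.Modules.Hom.zero_app]; rfl
  | succ c ih => rw [succ_nsmul, succ_nsmul, Scheme.Modules.Hom.add_app, ← ih]; rfl

/-- **The abstract `p`-adic ladder.** Under the neighbourhood-wise hypotheses of the file docstring,
`φ` is an epimorphism and multiplication by `a` induces an isomorphism `ν : R ⥲ ker φ` with
`ρ ≫ ν ≫ ker.ι = a · 𝟙_N`. -/
theorem ladderCore
    (hloc : ∀ y : Y, ∃ U : Y.Opens, y ∈ U ∧ ∀ V : Y.Opens, IsAffineOpen V → V ≤ U →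
      Function.Surjective (φ.app V) ∧ (∀ x : Γ(N, V), φ.app V x = 0 ↔ ∃ x', x = a • x') ∧
      Function.Surjective (ρ.app V) ∧ (∀ x : Γ(N, V), ρ.app V x = 0 ↔ ∃ x', x = b • x') ∧
      (∀ x : Γ(N, V), a • x = 0 → ∃ x', x = b • x') ∧ (∀ x : Γ(N, V), (a * b) • x = 0)) :
    Epi φ ∧ ∃ ν : R ⟶ kernel φ, IsIso ν ∧ ρ ≫ ν ≫ kernel.ι φ = a • 𝟙 N := by
  haveI hφ : Epi φ := epi_of_locally_surjective φ fun y => by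
    obtain ⟨U, hyU, hU⟩ := hloc y
    exact ⟨U, hyU, fun V hV hVU => (hU V hV hVU).1⟩
  haveI hρ : Epi ρ := epi_of_locally_surjective ρ fun y => by
    obtain ⟨U, hyU, hU⟩ := hloc y
    exact ⟨U, hyU, fun V hV hVU => (hU V hV hVU).2.2.1⟩
  -- `a · 𝟙_N` kills `ker ρ = b N` (as `ab N = 0`), hence descends along `ρ`
  have hker : kernel.ι ρ ≫ (a • 𝟙 N) = 0 := by
    refine hom_eq_of_locally_eq _ _ fun y => ?_
    obtain ⟨U, hyU, hU⟩ := hloc y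
    refine ⟨U, hyU, fun V hV hVU s => ?_⟩
    obtain ⟨-, -, -, h4, -, h6⟩ := hU V hV hVU
    obtain ⟨x', hx'⟩ := (h4 _).mp (app_kernel_ι_app ρ V s)
    change (a • 𝟙 N).app V ((kernel.ι ρ).app V s) = 0
    rw [nsmul_app_apply', Scheme.Modules.Hom.id_app, hx']
    change a • b • x' = 0
    rw [← mul_smul]
    exact h6 x'
  obtain ⟨ν₀, hν₀⟩ : ∃ ν₀ : R ⟶ N, ρ ≫ ν₀ = a • 𝟙 N := ⟨_, Abelian.comp_epiDesc ρ _ hker⟩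
  -- it lands in `ker φ` (`φ (a x) = 0`)
  have hνφ : ν₀ ≫ φ = 0 := by
    rw [← cancel_epi ρ, reassoc_of% hν₀, comp_zero]
    refine hom_eq_of_locally_eq _ _ fun y => ?_
    obtain ⟨U, hyU, hU⟩ := hloc y
    refine ⟨U, hyU, fun V hV hVU s => ?_⟩
    obtain ⟨-, h2, -⟩ := hU V hV hVU
    change φ.app V ((a • 𝟙 N).app V s) = 0
    rw [nsmul_app_apply', Scheme.Modules.Hom.id_app]
    exact (h2 _).mpr ⟨s, rfl⟩
  refine ⟨hφ, kernel.lift φ ν₀ hνφ, ?_, by rw [kernel.lift_ι, hν₀]⟩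
  -- `ν` is bijective on the small affine opens
  have hνρ : ∀ (V : Y.Opens) (x : Γ(N, V)),
      (kernel.ι φ).app V ((kernel.lift φ ν₀ hνφ).app V (ρ.app V x)) = a • x := by
    intro V x
    change (ρ ≫ kernel.lift φ ν₀ hνφ ≫ kernel.ι φ).app V x = a • x
    rw [kernel.lift_ι, hν₀, nsmul_app_apply', Scheme.Modules.Hom.id_app]
    rfl
  refine isIso_of_locally_bijective _ fun y => ?_
  obtain ⟨U, hyU, hU⟩ := hloc y
  refine ⟨U, hyU, fun V hV hVU => ⟨?_, ?_⟩⟩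
  · -- injective: `ν (ρ x) = 0 ⟹ a x = 0 ⟹ x ∈ b N ⟹ ρ x = 0`
    obtain ⟨-, -, h3, h4, h5, -⟩ := hU V hV hVU
    refine (injective_iff_map_eq_zero _).mpr fun r hr => ?_
    obtain ⟨x, rfl⟩ := h3 r
    have hax : a • x = 0 := by rw [← hνρ V x, hr, map_zero]
    obtain ⟨x', rfl⟩ := h5 x hax
    exact (h4 _).mpr ⟨x', rfl⟩
  · -- surjective: `k ∈ ker φ`, `ι k = a x'`, then `k = ν (ρ x')`
    obtain ⟨-, h2, -⟩ := hU V hV hVU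
    intro k
    obtain ⟨x', hx'⟩ := (h2 _).mp (app_kernel_ι_app φ V k)
    refine ⟨ρ.app V x', kernel_ι_app_injective φ V ?_⟩
    rw [hνρ V x', ← hx']

/-! ### Pushing the ladder forward along a closed immersion -/

/-- **The ladder, pushed forward along a closed immersion** `g : Y ⟶ Z`: with `ν : R ⥲ ker φ` as in
`ladderCore`, the sequence `0 → g_* R → g_* N → g_* P → 0` (first map `g_*(ν ≫ ker.ι)`, second map
`g_* φ`) is short exact, provided `g_* φ` is an epimorphism. -/
theorem shortExact_pushforward_of_isIso (g : Y ⟶ Z) (ν : R ⟶ kernel φ) [IsIso ν]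
    [Epi ((Scheme.Modules.pushforward g).map φ)] :
    (ShortComplex.mk ((Scheme.Modules.pushforward g).map (ν ≫ kernel.ι φ))
      ((Scheme.Modules.pushforward g).map φ)
      (by rw [← Functor.map_comp, Category.assoc, kernel.condition, comp_zero, Functor.map_zero])).ShortExact := by
  -- `R` with `ν ≫ ker.ι` is a kernel of `φ`, and `g_*` preserves kernels
  let c : KernelFork φ := KernelFork.ofι (ν ≫ kernel.ι φ) (by rw [Category.assoc, kernel.condition, comp_zero])
  have hc : IsLimit c := IsLimit.ofIsoLimit (kernelIsKernel φ)
    (Fork.ext (asIso ν).symm (by simp [c]))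
  have hc' : IsLimit (c.map (Scheme.Modules.pushforward g)) := KernelFork.mapIsLimit c hc _
  haveI : Mono ((Scheme.Modules.pushforward g).map (ν ≫ kernel.ι φ)) := by
    haveI : Mono (ν ≫ kernel.ι φ) := mono_comp _ _
    infer_instance
  exact ShortComplex.ShortExact.mk' (ShortComplex.exact_of_f_is_kernel _ hc') inferInstance inferInstance

/-- The direct image along a closed immersion of a morphism which is surjective on the small affine
opens is an epimorphism. -/
theorem epi_pushforward_map_of_locally_surjective (g : Y ⟶ Z) [IsClosedImmersion g]
    (h : ∀ y : Y, ∃ U : Y.Opens, y ∈ U ∧ ∀ V : Y.Opens, IsAffineOpen V → V ≤ U →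
      Function.Surjective (φ.app V)) :
    Epi ((Scheme.Modules.pushforward g).map φ) := by
  refine epi_of_locally_surjective _ fun z => ?_
  haveI := subsingleton_sections_bot P
  exact exists_nhds_preimage_of_isClosedImmersion g (fun V => Function.Surjective (φ.app V))
    (fun t => ⟨0, Subsingleton.elim _ _⟩) h z

end Ladder

/-- **Registered sub-goal** (helper stub of `stub_towerPresentation`, universe `0`): the abstract
`p`-adic ladder (`ladderCore`). -/
theorem stub_ladderCore :
    ∀ (Y : AlgebraicGeometry.Scheme.{0}) (N P R : Y.Modules) (φ : N ⟶ P) (ρ : N ⟶ R) (a b : ℕ),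
      (∀ y : Y, ∃ U : Y.Opens, y ∈ U ∧ ∀ V : Y.Opens, AlgebraicGeometry.IsAffineOpen V → V ≤ U →
        Function.Surjective (φ.app V) ∧ (∀ x : Γ(N, V), φ.app V x = 0 ↔ ∃ x', x = a • x') ∧
        Function.Surjective (ρ.app V) ∧ (∀ x : Γ(N, V), ρ.app V x = 0 ↔ ∃ x', x = b • x') ∧
        (∀ x : Γ(N, V), a • x = 0 → ∃ x', x = b • x') ∧ (∀ x : Γ(N, V), (a * b) • x = 0)) →
      CategoryTheory.Epi φ ∧ ∃ ν : R ⟶ CategoryTheory.Limits.kernel φ, CategoryTheory.IsIso ν ∧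
        ρ ≫ ν ≫ CategoryTheory.Limits.kernel.ι φ = a • 𝟙 N :=
  fun _ _ _ _ φ ρ a b hloc => ladderCore φ ρ a b hloc

end Summit.HodgeConjecture.HodgeConjecture.Theorems.FormalVectorBundlesAlgebraize

end
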